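import Summits.ValiantsHypothesis.ValiantsHypothesis.Theorems.GrenetZeonTwoDimCoefficientsDefs
import HarnessLib

/-!
# Crux `GrenetZeon.TwoDimCoefficients` (stmt-ValiantsHypothesis-8062), line `dim2_cases`:
# registered stub 1 `stub_classify` — the shape classification

Registered stub 1 of the planner's skeleton `Cruxes/TwoDimCoefficients/Lines/dim2_cases.lean`
(val-width-lines-2, 2026-08-27): an `(m, ≤ 2)`-representation of `per_n` (`HasDim2Repr n m`: a
commutative `ℂ`-algebra `R` with `finrank ≤ 2`, an affine `m × m` matrix `A` over `R[x]` and a linear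
functional `l : R → ℂ` carrying the coefficients of `det A` onto those of `per_n`) is SPLIT
(`per_n = α det A₁ + β det A₀`) or DUAL (`per_n = α det A₀ + β tr(adj A₀ · A₁)`).

Proof.  `R = 0` forces `per_n = 0`-representation, which is split with all data zero.  Otherwise
`R` has a character `φ₀ : R →ₐ[ℂ] ℂ` (a maximal ideal has residue field `ℂ`, `IsAlgClosed.lift`),
whose kernel has dimension `≤ 1`, spanned by some `e`, so `r = φ₀(r)·1 + c_r·e` for every `r`.
* If `e² = 0`: write `A = A₀ + (C e)·A₁` with `A₀ = φ₀(A)` and `A₁` the `e`-coordinates, and use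
  JACOBI'S FORMULA TO FIRST ORDER, `det (M + ε N) = det M + ε·tr(adj M · N)` whenever `ε² = 0`
  (`det_add_smul_of_mul_self_eq_zero`, proved here over any commutative ring by the Leibniz
  expansion and Cramer's rule, cf. the tree's `derivation_det_eq_trace`); applying `l`
  coefficientwise gives the DUAL shape with `α = l 1`, `β = l e`.
* If `e² ≠ 0`: `e² = κ e` with `κ ≠ 0`, `u = e/κ` is an idempotent `≠ 0, 1`, a maximal ideal through
  `1 - u` gives a second character `φ₁`, and `r = φ₁(r)·u + φ₀(r)·(1 - u)`; characters commute with
  `det` and `coeff` (`RingHom.map_det`, `MvPolynomial.coeff_map`), giving the SPLIT shape with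
  `α = l u`, `β = l (1 - u)`.
Total degrees do not increase under coefficient maps (`MvPolynomial.support_map_subset`).

HONEST FRAMING: algebra plumbing for an ASIDE binder of route `GrenetZeon`; closes no item
(`--supports stmt-ValiantsHypothesis-8062`); `VP ≠ VNP` is not moved by anything here.

References: N. Jacobson, *Basic Algebra I*, 2nd ed. (1985), §7.2 (Jacobi's formula
`d det = tr(adj · d)`); T. Mignon, N. Ressayre, Int. Math. Res. Not. 2004:79 (context only).
-/

set_option linter.dupNamespace false

noncomputable section

namespace Summit.ValiantsHypothesis.ValiantsHypothesis.Cruxes.TwoDimCoefficients.DimTwoCases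

open Literature.Computability.AlgebraicComplexity

/-! ### Jacobi's formula to first order over a commutative ring -/

section Jacobi

variable {S : Type*} [CommRing S]

/-- First-order expansion of a product: `∏ (fᵢ + ε gᵢ) = ∏ fᵢ + ε ∑ᵢ (∏_{j ≠ i} fⱼ) gᵢ` when
`ε² = 0`. -/
theorem prod_add_mul_of_mul_self_eq_zero {α : Type*} [DecidableEq α] (s : Finset α) (f g : α → S)
    {ε : S} (hε : ε * ε = 0) :
    ∏ i ∈ s, (f i + ε * g i) = ∏ i ∈ s, f i + ε * ∑ i ∈ s, (∏ j ∈ s.erase i, f j) * g i := by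
  induction s using Finset.induction_on with
  | empty => simp
  | insert a s ha ih =>
    rw [Finset.prod_insert ha, ih, Finset.sum_insert ha, Finset.erase_insert ha,
      Finset.prod_insert ha]
    have hsum : ∑ i ∈ s, (∏ j ∈ (insert a s).erase i, f j) * g i =
        f a * ∑ i ∈ s, (∏ j ∈ s.erase i, f j) * g i := by
      rw [Finset.mul_sum]
      refine Finset.sum_congr rfl fun i hi => ?_
      rw [Finset.erase_insert_of_ne (by rintro rfl; exact ha hi),
        Finset.prod_insert (fun h => ha (Finset.mem_of_mem_erase h)), mul_assoc]
    rw [hsum]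
    have h0 : ε * g a * (ε * ∑ i ∈ s, (∏ j ∈ s.erase i, f j) * g i) = 0 := by
      rw [show ε * g a * (ε * ∑ i ∈ s, (∏ j ∈ s.erase i, f j) * g i) =
          ε * ε * (g a * ∑ i ∈ s, (∏ j ∈ s.erase i, f j) * g i) by ring, hε, zero_mul]
    linear_combination h0

/-- First-order expansion of a determinant, column by column: for `ε² = 0`,
`det (M + ε N) = det M + ε ∑ⱼ det (M with its j-th column replaced by that of N)`. -/
theorem det_add_smul_eq_sum_updateCol {m : Type*} [Fintype m] [DecidableEq m] {ε : S}
    (hε : ε * ε = 0) (M N : Matrix m m S) :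
    (M + ε • N).det = M.det + ε * ∑ j, (M.updateCol j fun i => N i j).det := by
  simp only [Matrix.det_apply', Matrix.add_apply, Matrix.smul_apply, smul_eq_mul,
    prod_add_mul_of_mul_self_eq_zero _ _ _ hε, mul_add, Finset.sum_add_distrib]
  congr 1
  simp_rw [Finset.mul_sum]
  rw [Finset.sum_comm]
  refine Finset.sum_congr rfl fun j _ => Finset.sum_congr rfl fun σ _ => ?_
  have hprod : (∏ i ∈ Finset.univ.erase j, M (σ i) i) * N (σ j) j =
      ∏ i, (M.updateCol j fun i => N i j) (σ i) i := by
    rw [← Finset.prod_erase_mul Finset.univ _ (Finset.mem_univ j)]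
    simp only [Matrix.updateCol_self]
    congr 1
    exact Finset.prod_congr rfl fun i hi => by
      simp only [Matrix.updateCol_ne (Finset.ne_of_mem_erase hi)]
  rw [← hprod]
  ring

/-- **Jacobi's formula to first order.** Over any commutative ring, if `ε² = 0` then
`det (M + ε N) = det M + ε·tr(adj M · N)`. -/
theorem det_add_smul_of_mul_self_eq_zero {m : Type*} [Fintype m] [DecidableEq m] {ε : S}
    (hε : ε * ε = 0) (M N : Matrix m m S) :
    (M + ε • N).det = M.det + ε * (M.adjugate * N).trace := by
  rw [det_add_smul_eq_sum_updateCol hε]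
  simp only [← Matrix.cramer_apply, Matrix.cramer_eq_adjugate_mulVec, Matrix.trace, Matrix.diag,
    Matrix.mul_apply, Matrix.mulVec, dotProduct]

end Jacobi

/-! ### Coefficient maps on polynomials -/

section CoeffMap

variable {σ : Type*} {R : Type*} [CommRing R]

/-- Total degree does not increase under `MvPolynomial.map`. -/
theorem totalDegree_map_le {S' : Type*} [CommRing S'] (f : R →+* S') (p : MvPolynomial σ R) :
    (MvPolynomial.map f p).totalDegree ≤ p.totalDegree :=
  Finset.sup_mono (MvPolynomial.support_map_subset f p)

/-- Applying an arbitrary coefficient function `Ψ : R → ℂ` on the support,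
`p ↦ ∑_{d ∈ supp p} Ψ(p_d) x^d`: the coefficients are `Ψ` of those of `p`, on the support of `p`. -/
theorem coeff_sum_monomial_support [DecidableEq σ] (Ψ : R → ℂ) (p : MvPolynomial σ R)
    (d : σ →₀ ℕ) :
    (∑ d' ∈ p.support, MvPolynomial.monomial d' (Ψ (p.coeff d'))).coeff d =
      if d ∈ p.support then Ψ (p.coeff d) else 0 := by
  simp only [MvPolynomial.coeff_sum, MvPolynomial.coeff_monomial, Finset.sum_ite_eq']

/-- The coefficient map `p ↦ ∑_{d ∈ supp p} Ψ(p_d) x^d` does not enlarge the support. -/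
theorem support_sum_monomial_support_subset (Ψ : R → ℂ) (p : MvPolynomial σ R) :
    (∑ d' ∈ p.support, MvPolynomial.monomial d' (Ψ (p.coeff d'))).support ⊆ p.support := by
  classical
  intro d hd
  rw [MvPolynomial.mem_support_iff, coeff_sum_monomial_support] at hd
  by_contra h
  exact hd (if_neg h)

/-- The coefficient map `p ↦ ∑_{d ∈ supp p} Ψ(p_d) x^d` does not increase the total degree. -/
theorem totalDegree_sum_monomial_support_le (Ψ : R → ℂ) (p : MvPolynomial σ R) :
    (∑ d' ∈ p.support, MvPolynomial.monomial d' (Ψ (p.coeff d'))).totalDegree ≤ p.totalDegree :=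
  Finset.sup_mono (support_sum_monomial_support_subset Ψ p)

end CoeffMap

/-! ### Finite-dimensional commutative `ℂ`-algebras of dimension `≤ 2` -/

section Algebras

variable {R : Type*} [CommRing R] [Algebra ℂ R] [Module.Finite ℂ R]

/-- A maximal ideal of a finite-dimensional commutative `ℂ`-algebra is the kernel of a character
(its residue field is a finite extension of `ℂ`, hence `ℂ`). -/
theorem exists_algHom_of_isMaximal (𝔪 : Ideal R) (h𝔪 : 𝔪.IsMaximal) :
    ∃ φ : R →ₐ[ℂ] ℂ, ∀ r ∈ 𝔪, φ r = 0 := by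
  haveI := h𝔪
  letI : Field (R ⧸ 𝔪) := Ideal.Quotient.field 𝔪
  haveI : Module.Finite ℂ (R ⧸ 𝔪) :=
    Module.Finite.of_surjective (Ideal.Quotient.mkₐ ℂ 𝔪).toLinearMap
      (Ideal.Quotient.mkₐ_surjective ℂ 𝔪)
  haveI : Algebra.IsAlgebraic ℂ (R ⧸ 𝔪) := Algebra.IsAlgebraic.of_finite ℂ _
  refine ⟨(IsAlgClosed.lift : (R ⧸ 𝔪) →ₐ[ℂ] ℂ).comp (Ideal.Quotient.mkₐ ℂ 𝔪), fun r hr => ?_⟩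
  rw [AlgHom.comp_apply, Ideal.Quotient.mkₐ_eq_mk, Ideal.Quotient.eq_zero_iff_mem.mpr hr,
    map_zero]

/-- A non-trivial finite-dimensional commutative `ℂ`-algebra has a character. -/
theorem nonempty_algHom [Nontrivial R] : Nonempty (R →ₐ[ℂ] ℂ) := by
  obtain ⟨𝔪, h𝔪⟩ := Ideal.exists_maximal R
  obtain ⟨φ, -⟩ := exists_algHom_of_isMaximal 𝔪 h𝔪
  exact ⟨φ⟩

/-- In dimension `≤ 2`, the kernel of a character `φ` is spanned by one element `e`:
`r = φ(r)·1 + c·e`. -/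
theorem exists_ker_generator (hdim : Module.finrank ℂ R ≤ 2) (φ : R →ₐ[ℂ] ℂ) :
    ∃ e : R, φ e = 0 ∧ ∀ r : R, ∃ c : ℂ, r = φ r • (1 : R) + c • e := by
  let K : Submodule ℂ R := LinearMap.ker φ.toLinearMap
  have hK : K ≠ ⊤ := by
    intro h
    have h1 : (1 : R) ∈ K := h ▸ Submodule.mem_top
    rw [LinearMap.mem_ker, AlgHom.toLinearMap_apply, map_one] at h1
    exact one_ne_zero h1
  have hK1 : Module.finrank ℂ K ≤ 1 := by
    have := Submodule.finrank_lt hK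
    omega
  obtain ⟨v, hv⟩ := finrank_le_one_iff.mp hK1
  refine ⟨(v : R), ?_, fun r => ?_⟩
  · have := v.2
    rwa [LinearMap.mem_ker, AlgHom.toLinearMap_apply] at this
  · have hr : r - φ r • (1 : R) ∈ K := by
      rw [LinearMap.mem_ker, AlgHom.toLinearMap_apply, map_sub, map_smul, map_one, smul_eq_mul,
        mul_one, sub_self]
    obtain ⟨c, hc⟩ := hv ⟨_, hr⟩
    refine ⟨c, ?_⟩
    have hc' := congrArg Subtype.val hc
    simp only [Submodule.coe_smul] at hc'
    rw [hc']; abel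

omit [Module.Finite ℂ R] in
/-- If a character's kernel is spanned by `e` and contains `g ≠ 0`, it is spanned by `g`. -/
theorem ker_generator_of_mem {φ : R →ₐ[ℂ] ℂ} {e g : R}
    (he : ∀ r : R, ∃ c : ℂ, r = φ r • (1 : R) + c • e) (hg : φ g = 0) (hg0 : g ≠ 0) :
    ∀ r : R, ∃ c : ℂ, r = φ r • (1 : R) + c • g := by
  obtain ⟨c₀, hc₀⟩ := he g
  rw [hg, zero_smul, zero_add] at hc₀
  have hc₀0 : c₀ ≠ 0 := by rintro rfl; exact hg0 (by rw [hc₀, zero_smul])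
  intro r
  obtain ⟨c, hc⟩ := he r
  refine ⟨c * c₀⁻¹, ?_⟩
  rw [mul_smul, hc₀, smul_smul c₀⁻¹, inv_mul_cancel₀ hc₀0, one_smul]
  exact hc

end Algebras

/-! ### The two shapes -/

section Shapes

variable {R : Type} [CommRing R] [Algebra ℂ R] {n m : ℕ}

/-- SPLIT: two characters `φ₁, φ₀` and `u, v ∈ R` with `r = φ₁(r)·u + φ₀(r)·v` for all `r` turn an
`R`-representation into `per_n = (l u)·det φ₁(A) + (l v)·det φ₀(A)`. -/
theorem splitRepr_of_characters (φ₁ φ₀ : R →ₐ[ℂ] ℂ) (u v : R)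
    (hspan : ∀ r : R, r = φ₁ r • u + φ₀ r • v) (l : R →ₗ[ℂ] ℂ)
    (A : Matrix (Fin m) (Fin m) (MvPolynomial (Fin n × Fin n) R))
    (hA : ∀ i j, (A i j).totalDegree ≤ 1)
    (hcoeff : ∀ d : (Fin n × Fin n) →₀ ℕ,
      l (MvPolynomial.coeff d A.det) = MvPolynomial.coeff d (perPoly (Fin n) ℂ)) :
    SplitRepr n m := by
  refine ⟨l u, l v, (MvPolynomial.map (φ₁ : R →+* ℂ)).mapMatrix A,
    (MvPolynomial.map (φ₀ : R →+* ℂ)).mapMatrix A,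
    fun i j => (totalDegree_map_le _ _).trans (hA i j),
    fun i j => (totalDegree_map_le _ _).trans (hA i j), ?_⟩
  ext d
  rw [← hcoeff d, ← RingHom.map_det, ← RingHom.map_det]
  conv_lhs => rw [hspan (MvPolynomial.coeff d A.det)]
  simp only [MvPolynomial.coeff_add, MvPolynomial.coeff_C_mul, MvPolynomial.coeff_map, map_add,
    map_smul, smul_eq_mul, RingHom.coe_coe]
  ring

/-- DUAL: a character `φ`, an element `e` with `e² = 0` and `r = φ(r)·1 + c_r·e` for all `r` turn an
`R`-representation into `per_n = (l 1)·det A₀ + (l e)·tr(adj A₀ · A₁)` (Jacobi to first order). -/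
theorem dualRepr_of_character (φ : R →ₐ[ℂ] ℂ) (e : R) (hee : e * e = 0)
    (hspan : ∀ r : R, ∃ c : ℂ, r = φ r • (1 : R) + c • e) (l : R →ₗ[ℂ] ℂ)
    (A : Matrix (Fin m) (Fin m) (MvPolynomial (Fin n × Fin n) R))
    (hA : ∀ i j, (A i j).totalDegree ≤ 1)
    (hcoeff : ∀ d : (Fin n × Fin n) →₀ ℕ,
      l (MvPolynomial.coeff d A.det) = MvPolynomial.coeff d (perPoly (Fin n) ℂ)) :
    DualRepr n m := by
  classical
  choose Ψ hΨ using hspan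
  -- the two coordinate matrices over `ℂ[x]`
  set A₀ : AffMat n m := (MvPolynomial.map (φ : R →+* ℂ)).mapMatrix A with hA₀
  set A₁ : AffMat n m := Matrix.of fun i j =>
    ∑ d' ∈ (A i j).support, MvPolynomial.monomial d' (Ψ ((A i j).coeff d')) with hA₁
  -- back to `R[x]`
  set ι : MvPolynomial (Fin n × Fin n) ℂ →+* MvPolynomial (Fin n × Fin n) R :=
    MvPolynomial.map (algebraMap ℂ R) with hι
  have hdecomp :
      A = ι.mapMatrix A₀ + (MvPolynomial.C e : MvPolynomial (Fin n × Fin n) R) • ι.mapMatrix A₁ := by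
    ext i j d
    simp only [Matrix.add_apply, Matrix.smul_apply, RingHom.mapMatrix_apply, Matrix.map_apply,
      hA₀, hA₁, Matrix.of_apply, smul_eq_mul, MvPolynomial.coeff_add, MvPolynomial.coeff_C_mul,
      hι, MvPolynomial.coeff_map, coeff_sum_monomial_support, RingHom.coe_coe]
    by_cases hd : d ∈ (A i j).support
    · rw [if_pos hd]
      conv_lhs => rw [hΨ (MvPolynomial.coeff d (A i j))]
      rw [Algebra.smul_def, mul_one, Algebra.smul_def, mul_comm e]
    · rw [if_neg hd, MvPolynomial.notMem_support_iff.mp hd]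
      simp only [map_zero, mul_zero, add_zero]
  have hε : (MvPolynomial.C e : MvPolynomial (Fin n × Fin n) R) * MvPolynomial.C e = 0 := by
    rw [← map_mul, hee, map_zero]
  have hdet : A.det = ι A₀.det +
      (MvPolynomial.C e : MvPolynomial (Fin n × Fin n) R) * ι (A₀.adjugate * A₁).trace := by
    rw [hdecomp, det_add_smul_of_mul_self_eq_zero hε, RingHom.map_det, ← RingHom.map_adjugate,
      ← map_mul]
    congr 1
    congr 1
    simp only [Matrix.trace, Matrix.diag, map_sum, RingHom.mapMatrix_apply, Matrix.map_apply]
  refine ⟨l 1, l e, A₀, A₁, fun i j => (totalDegree_map_le _ _).trans (hA i j),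
    fun i j => (totalDegree_sum_monomial_support_le _ _).trans (hA i j), ?_⟩
  ext d
  rw [← hcoeff d, hdet]
  simp only [MvPolynomial.coeff_add, MvPolynomial.coeff_C_mul, hι, MvPolynomial.coeff_map,
    Algebra.algebraMap_eq_smul_one, mul_smul_comm, mul_one, map_add, map_smul, smul_eq_mul]
  ring

end Shapes

/-! ### The registered stub -/

section Stub

/-- **Registered stub 1 (`stub_classify`) of line `dim2_cases`.** An `(m, ≤ 2)`-representation of
`per_n` is SPLIT or DUAL. -/
theorem stub_classify : ∀ n m : ℕ, HasDim2Repr n m → SplitRepr n m ∨ DualRepr n m := by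
  rintro n m ⟨R, _, _, _, hdim, l, A, hA, hcoeff⟩
  rcases subsingleton_or_nontrivial R with hR | hR
  · -- `R = 0`: every coefficient of `per_n` vanishes, and `0` is a split representation.
    left
    have hper : perPoly (Fin n) ℂ = 0 := by
      ext d
      rw [← hcoeff d, Subsingleton.elim (MvPolynomial.coeff d A.det) 0, map_zero,
        MvPolynomial.coeff_zero]
    refine ⟨0, 0, 0, 0, fun i j => ?_, fun i j => ?_, ?_⟩
    · simp
    · simp
    · simp [hper]
  · obtain ⟨φ₀⟩ := nonempty_algHom (R := R)
    obtain ⟨e, he, hspan⟩ := exists_ker_generator hdim φ₀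
    by_cases hee : e * e = 0
    · exact Or.inr (dualRepr_of_character φ₀ e hee hspan l A hA hcoeff)
    · left
      -- `e² = κ e` with `κ ≠ 0`; `u = e/κ` is an idempotent in `ker φ₀`, `u ≠ 0`, `1 - u ≠ 0`.
      obtain ⟨κ, hκ⟩ := hspan (e * e)
      rw [map_mul, he, mul_zero, zero_smul, zero_add] at hκ
      have hκ0 : κ ≠ 0 := by rintro rfl; exact hee (by rw [hκ, zero_smul])
      have he0 : e ≠ 0 := by rintro rfl; exact hee (mul_zero _)
      set u : R := κ⁻¹ • e with hu
      have heu : e = κ • u := by rw [hu, smul_smul, mul_inv_cancel₀ hκ0, one_smul]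
      have huu : u * u = u := by
        rw [hu, smul_mul_smul_comm, hκ, smul_smul, mul_assoc, inv_mul_cancel₀ hκ0, mul_one]
      have hu0 : u ≠ 0 := by
        intro h; apply he0; rw [heu, h, smul_zero]
      have hφu : φ₀ u = 0 := by rw [hu, map_smul, he, smul_zero]
      have hvu : (1 - u) * u = 0 := by rw [sub_mul, one_mul, huu, sub_self]
      have hv_unit : ¬IsUnit (1 - u) := fun h =>
        hu0 (h.mul_right_injective (hvu.trans (mul_zero _).symm))
      -- a second character, vanishing on `1 - u`
      obtain ⟨𝔪, h𝔪, hle⟩ := Ideal.exists_le_maximal (Ideal.span {1 - u})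
        ((Ideal.span_singleton_ne_top) hv_unit)
      obtain ⟨φ₁, hφ₁⟩ := exists_algHom_of_isMaximal 𝔪 h𝔪
      have hφ₁v : φ₁ (1 - u) = 0 := hφ₁ _ (hle (Ideal.mem_span_singleton_self _))
      have hv0 : (1 : R) - u ≠ 0 := by
        intro h
        have : φ₀ (1 - u) = 0 := by rw [h, map_zero]
        rw [map_sub, map_one, hφu, sub_zero] at this
        exact one_ne_zero this
      -- coordinates with respect to `φ₁` along `1 - u`
      obtain ⟨e₁, -, hspan₁⟩ := exists_ker_generator hdim φ₁
      have hspan₁' := ker_generator_of_mem hspan₁ hφ₁v hv0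
      have hspanu := ker_generator_of_mem hspan hφu hu0
      refine splitRepr_of_characters φ₁ φ₀ u (1 - u) (fun r => ?_) l A hA hcoeff
      obtain ⟨c₁, hc₁⟩ := hspan₁' r
      obtain ⟨c₀, hc₀⟩ := hspanu r
      have h1 : r * u = φ₁ r • u := by
        conv_lhs => rw [hc₁]
        rw [add_mul, smul_mul_assoc, one_mul, smul_mul_assoc, hvu, smul_zero, add_zero]
      have h2 : r * (1 - u) = φ₀ r • (1 - u) := by
        conv_lhs => rw [hc₀]
        rw [add_mul, smul_mul_assoc, one_mul, smul_mul_assoc, mul_comm u, hvu, smul_zero,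
          add_zero]
      calc r = r * u + r * (1 - u) := by ring
        _ = φ₁ r • u + φ₀ r • (1 - u) := by rw [h1, h2]

end Stub

end Summit.ValiantsHypothesis.ValiantsHypothesis.Cruxes.TwoDimCoefficients.DimTwoCases
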